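import Summits.CriticalPhenomena.PercolationContinuityZ3.Theses.PercExchangeRateTransport
import Literature.Probability.Percolation.GrimmettMarstrand
import Literature.Probability.Percolation.SubgraphMonotonicity
import Literature.Probability.LatticeModels.ProdBernoulliCoupling
import Literature.Probability.Percolation.PercolationProofs

/-!
# Sketch — crux-ideate round 1 (ideator 1) for `ModelFacts` (stmt-CriticalPhenomena-16064)

First lemmas of the two idea cards, stated over existing declarations (they need not be
proved here; they must elaborate).

* Card `ambient-comap-planar-end`: compute `θ_{ℤ²}` ON THE AMBIENT SPACE `ℤ³` through
  `theta_comap_eq` and the layer embedding `padSite 3 : Site 2 → Site 3`; clause (10) of the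
  crux becomes an (a.s.) identity of EVENTS under the single measure `bondPercolation (zdGraph 3) p`.
* Card `ae-relabel-keystone`: the two-parameter label push-forward (keystone stub of the
  registered line `pushforward`) is the tree's `prodBernoulli_eq_map_labels` precomposed with an
  a.e.-equal relabelling (`Measure.map_congr`).
-/

noncomputable section

open MeasureTheory
open Literature.Probability.Percolation Literature.Probability.LatticeModels

namespace Summit.CriticalPhenomena.PercolationContinuityZ3.Cruxes.ModelFacts.Sketch

/-! ## Verbatim copies of two registered stubs of line `pushforward` (text = ledger signatures;
the line module itself is a crux workfile, not a farm-built import) -/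
namespace StubsCopy

/-- = `Pushforward.Stubs.stub_pushforward` (registered signature, verbatim). -/
def stub_pushforward : Prop :=
  ∀ (E : Set (Sym2 (Site 3))) (τ : Sym2 (Site 3) → ℝ),
    (labelMeasure (Site 3)).map (fun U : Sym2 (Site 3) → ℝ => {e | e ∈ E ∧ U e ≤ τ e}) =
      prodBernoulli (E.indicator fun e => Set.projIcc (0 : ℝ) 1 zero_le_one (τ e))

/-- = `Pushforward.Stubs.stub_planar` (registered signature, verbatim). -/
def stub_planar : Prop :=
  ∀ p : unitInterval,
    (labelMeasure (Site 3)).real {U |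
      {e | e ∈ (zdGraph 3).edgeSet ∧ ¬ (∃ x : Site 3, e = s(x, x + Pi.single (2 : Fin 3) 1)) ∧
        U e ≤ (p : ℝ)} ∈ percolatesAt (0 : Site 3)} = theta (zdGraph 2) 0 p

end StubsCopy

/-- The vertical bonds of `ℤ²×ℤ` (the crux's `vert`). -/
def Vert : Set (Sym2 (Site 3)) := {e | ∃ x : Site 3, e = s(x, x + Pi.single (2 : Fin 3) 1)}

/-! ## Card `ambient-comap-planar-end` -/

/-- First lemma (a): the layer embedding pulls `ℤ³` back to `ℤ²` — `(zdGraph 3).comap padSite = zdGraph 2`. -/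
theorem comap_padSite_three : (zdGraph 3).comap (padSite 3) = zdGraph 2 := by
  ext u v
  simp only [SimpleGraph.comap_adj]
  constructor
  · intro h
    rw [zdGraph_adj_iff] at h ⊢
    obtain ⟨i, h⟩ := h
    -- the unit vector must be horizontal: compare third coordinates
    have hi : (i : ℕ) < 2 := by
      rcases h with h | h
      · have := congrFun h i
        by_contra hi
        simp [padSite, hi] at this
      · have := congrFun h i
        by_contra hi
        simp [padSite, hi] at this
    refine ⟨⟨i, hi⟩, ?_⟩
    have hcast : Fin.castLE (show 2 ≤ 3 by norm_num) ⟨i, hi⟩ = i := Fin.ext rfl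
    rcases h with h | h
    · left
      apply padSite_injective (d := 3) (by norm_num)
      rw [padSite_add, padSite_single (by norm_num), hcast]
      exact h
    · right
      apply padSite_injective (d := 3) (by norm_num)
      rw [padSite_add, padSite_single (by norm_num), hcast]
      exact h
  · exact zdGraph_adj_padSite (by norm_num)

/-- First lemma (b): on configurations carried by `E(ℤ³)`, "the origin percolates through
horizontal bonds" is the pull-back along `padSite` of planar percolation (layer confinement +
`reachable_map_of_restrictConfig`). -/
theorem horiz_step {u x : Site 3} (hE : (zdGraph 3).Adj u x) (hnv : s(u, x) ∉ Vert)
    (a : Site 2) (ha : padSite 3 a = u) :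
    ∃ a' : Site 2, padSite 3 a' = x ∧ (zdGraph 2).Adj a a' := by
  rw [zdGraph_adj_iff] at hE
  obtain ⟨i, hi⟩ := hE
  have two_le : (2 : ℕ) ≤ 3 := by norm_num
  -- the step is horizontal: a vertical unit vector would make `s(u, x)` a vertical bond
  have hi2 : (i : ℕ) < 2 := by
    by_contra hlt
    apply hnv
    simp only [Vert, Set.mem_setOf_eq]
    fin_cases i
    · simp at hlt
    · simp at hlt
    · rcases hi with h | h
      · exact ⟨u, by rw [h]; rfl⟩
      · exact ⟨x, by rw [h, Sym2.eq_swap]; rfl⟩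
  set j : Fin 2 := ⟨i, hi2⟩ with hj
  have hcast : Fin.castLE two_le j = i := Fin.ext rfl
  rcases hi with h | h
  · refine ⟨a + Pi.single j 1, ?_, ?_⟩
    · rw [padSite_add, padSite_single two_le, hcast, ha, h]
    · rw [zdGraph_adj_iff]; exact ⟨j, Or.inl rfl⟩
  · refine ⟨a - Pi.single j 1, ?_, ?_⟩
    · have hpad : padSite 3 (a - Pi.single j 1) + padSite 3 (Pi.single j 1) = padSite 3 a := by
        rw [← padSite_add, sub_add_cancel]
      rw [padSite_single two_le, hcast, ha, h] at hpad
      exact add_right_cancel hpad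
    · rw [zdGraph_adj_iff]; exact ⟨j, Or.inr (sub_add_cancel a _).symm⟩

/-- Layer confinement: an open path of horizontal lattice bonds starting on the layer `x₂ = 0`
stays on it and is the `padSite`-image of an open path of the restricted planar configuration. -/
theorem lift_walk {ω : BondConfig (Site 3)} (hω : ω ⊆ (zdGraph 3).edgeSet) {u v : Site 3}
    (w : (openGraph (ω \ Vert)).Walk u v) :
    ∀ a : Site 2, padSite 3 a = u →
      ∃ b : Site 2, padSite 3 b = v ∧ (openGraph (restrictConfig (padSite 3) (ω \ Vert))).Reachable a b := by
  induction w with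
  | nil => intro a ha; exact ⟨a, ha, SimpleGraph.Reachable.refl _⟩
  | @cons u x v hadj w' ih =>
    intro a ha
    rw [openGraph_adj] at hadj
    obtain ⟨hmem, hne⟩ := hadj
    have hE : (zdGraph 3).Adj u x := hω hmem.1
    obtain ⟨a', ha', hadj2⟩ := horiz_step hE hmem.2 a ha
    obtain ⟨b, hb, hreach⟩ := ih a' ha'
    refine ⟨b, hb, ?_⟩
    have h1 : (openGraph (restrictConfig (padSite 3) (ω \ Vert))).Adj a a' := by
      rw [openGraph_adj]
      refine ⟨?_, hadj2.ne⟩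
      rw [mem_restrictConfig, Sym2.map_mk, ha, ha']
      exact hmem
    exact h1.reachable.trans hreach

/-- No vertical bond is the `padSite`-image of a planar pair. -/
theorem map_padSite_notMem_Vert (e : Sym2 (Site 2)) : e.map (padSite 3) ∉ Vert := by
  induction e using Sym2.ind with
  | h a b =>
    rintro ⟨x, hx⟩
    rw [Sym2.map_mk, Sym2.eq_iff] at hx
    have h2a : padSite 3 a 2 = 0 := by simp [padSite]
    have h2b : padSite 3 b 2 = 0 := by simp [padSite]
    rcases hx with ⟨h1, h2⟩ | ⟨h1, h2⟩
    · have := congrFun h2 2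
      rw [h2b, Pi.add_apply, ← h1, h2a] at this
      simp at this
    · have := congrFun h1 2
      rw [h2a, Pi.add_apply, ← h2, h2b] at this
      simp at this

theorem horiz_percolatesAt_iff {ω : BondConfig (Site 3)} (hω : ω ⊆ (zdGraph 3).edgeSet) :
    ω \ Vert ∈ percolatesAt (0 : Site 3) ↔
      restrictConfig (padSite 3) ω ∈ percolatesAt (0 : Site 2) := by
  have hres : restrictConfig (padSite 3) ω = restrictConfig (padSite 3) (ω \ Vert) := by
    ext e
    simp only [mem_restrictConfig, Set.mem_sdiff]
    exact ⟨fun h => ⟨h, map_padSite_notMem_Vert e⟩, fun h => h.1⟩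
  simp only [percolatesAt, Set.mem_setOf_eq]
  rw [hres]
  constructor
  · intro h3
    have hsub : openCluster (ω \ Vert) (0 : Site 3) ⊆
        padSite 3 '' openCluster (restrictConfig (padSite 3) (ω \ Vert)) 0 := by
      intro y hy
      have hy' : (openGraph (ω \ Vert)).Reachable 0 y := hy
      obtain ⟨w⟩ := hy'
      obtain ⟨b, hb, hreach⟩ := lift_walk hω w 0 padSite_zero
      exact ⟨b, hreach, hb⟩
    exact Set.Infinite.of_image _ (h3.mono hsub)
  · intro h2
    by_contra h3
    have h3' : (openCluster (ω \ Vert) (padSite 3 (0 : Site 2))).Finite := by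
      rw [padSite_zero]; exact Set.not_infinite.1 h3
    exact h2 (finite_openCluster_restrictConfig (padSite_injective (d := 3) (by norm_num)) (ω \ Vert) 0 h3')

/-- Target reformulation of `stub_planar` in ambient form: under `P_p^{ℤ³}` the horizontal
percolation event has probability `θ_{ℤ²}(p)` (`theta_comap_eq` + `comap_padSite_three` +
`horiz_percolatesAt_iff` a.s., `setBernoulli_ae_subset`). -/
theorem planar_end_ambient (p : unitInterval) :
    (bondPercolation (zdGraph 3) p).real {ω | ω \ Vert ∈ percolatesAt (0 : Site 3)} =
      theta (zdGraph 2) 0 p := by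
  have h := theta_comap_eq (zdGraph 3) (padSite_injective (d := 3) (by norm_num)) (0 : Site 2) p
  rw [comap_padSite_three] at h
  rw [h]
  apply measureReal_congr
  have hsub : ∀ᵐ ω ∂(bondPercolation (zdGraph 3) p), ω ⊆ (zdGraph 3).edgeSet :=
    ProbabilityTheory.setBernoulli_ae_subset
  filter_upwards [hsub] with ω hω
  exact propext (horiz_percolatesAt_iff hω)

/-- The tree identity the card leans on, instantiated (elaboration check): `θ_{ℤ²}` computed on `ℤ³`. -/
example (p : unitInterval) :
    theta (zdGraph 2) 0 p =
      (bondPercolation (zdGraph 3) p).real (restrictConfig (padSite 3) ⁻¹' percolatesAt (0 : Site 2)) := by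
  have h := theta_comap_eq (zdGraph 3) (padSite_injective (d := 3) (by norm_num)) (0 : Site 2) p
  rw [comap_padSite_three] at h
  exact h

/-- `stub_planar` of the registered line, verbatim (what the card discharges). -/
def PlanarEnd : Prop :=
  ∀ p : unitInterval,
    (labelMeasure (Site 3)).real {U |
      {e | e ∈ (zdGraph 3).edgeSet ∧ ¬ (∃ x : Site 3, e = s(x, x + Pi.single (2 : Fin 3) 1)) ∧
        U e ≤ (p : ℝ)} ∈ percolatesAt (0 : Site 3)} = theta (zdGraph 2) 0 p

/-- `ω ↦ ω ∖ Vert` is measurable (coordinatewise). -/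
theorem measurable_sdiff_Vert : Measurable (fun ω : BondConfig (Site 3) => ω \ Vert) :=
  measurable_set_iff.2 fun e => (measurable_set_mem e).and measurable_const

/-- **`stub_planar` from the ambient identity** — NO a.s. step and no label transport on the
label side: the horizontal label configuration IS `configOfLabels p U (zdGraph 3) ∖ Vert`
(surely), so the one-level coupling `map_configOfLabels_holds` (the lemma of clause (9)) moves
the statement to `P_p^{ℤ³}`, where `planar_end_ambient` applies. Sorry-free modulo
`horiz_percolatesAt_iff`. -/
theorem planarEnd_of_ambient : PlanarEnd := by
  intro p
  have hmeas : MeasurableSet {ω : BondConfig (Site 3) | ω \ Vert ∈ percolatesAt (0 : Site 3)} :=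
    measurable_sdiff_Vert (measurableSet_percolatesAt_holds 0)
  have hset : {U : Sym2 (Site 3) → ℝ |
      {e | e ∈ (zdGraph 3).edgeSet ∧ ¬ (∃ x : Site 3, e = s(x, x + Pi.single (2 : Fin 3) 1)) ∧
        U e ≤ (p : ℝ)} ∈ percolatesAt (0 : Site 3)} =
      (fun U : Sym2 (Site 3) → ℝ => configOfLabels (p : ℝ) U (zdGraph 3)) ⁻¹'
        {ω | ω \ Vert ∈ percolatesAt (0 : Site 3)} := by
    ext U
    simp only [Set.mem_setOf_eq, Set.mem_preimage]
    have : {e | e ∈ (zdGraph 3).edgeSet ∧ ¬ (∃ x : Site 3, e = s(x, x + Pi.single (2 : Fin 3) 1)) ∧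
        U e ≤ (p : ℝ)} = configOfLabels (p : ℝ) U (zdGraph 3) \ Vert := by
      ext e
      simp only [configOfLabels, Vert, Set.mem_sdiff, Set.mem_setOf_eq]
      tauto
    rw [this]
  rw [hset, ← map_measureReal_apply (measurable_configOfLabels _ _) hmeas,
    map_configOfLabels_holds (zdGraph 3) p]
  exact planar_end_ambient p

/-- It is the registered hardest stub, by name — sorry-free. -/
theorem stub_planar_proof : StubsCopy.stub_planar := planarEnd_of_ambient

/-! ## Card `ae-relabel-keystone` -/

/-- First lemma: thresholding at a real field `τ` on `E` agrees a.e. with thresholding at the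
clamped, zero-extended `unitInterval` field (labels lie in `(0,1)` a.s.). -/
theorem threshold_ae_eq (E : Set (Sym2 (Site 3))) (τ : Sym2 (Site 3) → ℝ) :
    (fun U : Sym2 (Site 3) → ℝ => {e | e ∈ E ∧ U e ≤ τ e}) =ᵐ[labelMeasure (Site 3)]
      (fun U => {e | U e ≤ ((E.indicator fun e => Set.projIcc (0 : ℝ) 1 zero_le_one (τ e)) e : ℝ)}) := by
  have hP : IsProbabilityMeasure ((volume : Measure ℝ).restrict (Set.Icc (0 : ℝ) 1)) :=
    ⟨by simp [Real.volume_Icc]⟩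
  -- a.e. every label lies in the OPEN interval `(0, 1)`
  have h1 : ∀ e : Sym2 (Site 3), ∀ᵐ U ∂(labelMeasure (Site 3)), U e ∈ Set.Ioo (0 : ℝ) 1 := by
    intro e
    have hmap := Measure.infinitePi_map_eval
      (fun _ : Sym2 (Site 3) => (volume : Measure ℝ).restrict (Set.Icc (0 : ℝ) 1)) e
    have h' : ∀ᵐ s ∂((labelMeasure (Site 3)).map (fun U => U e)), s ∈ Set.Ioo (0 : ℝ) 1 := by
      rw [show labelMeasure (Site 3) = Measure.infinitePi
        (fun _ : Sym2 (Site 3) => (volume : Measure ℝ).restrict (Set.Icc (0 : ℝ) 1)) from rfl, hmap,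
        ae_restrict_iff' measurableSet_Icc]
      have h0 : (volume : Measure ℝ) {0, 1} = 0 := (Set.toFinite _).measure_zero _
      filter_upwards [measure_eq_zero_iff_ae_notMem.1 h0] with s hs hsI
      simp only [Set.mem_insert_iff, Set.mem_singleton_iff, not_or] at hs
      exact ⟨lt_of_le_of_ne hsI.1 (Ne.symm hs.1), lt_of_le_of_ne hsI.2 hs.2⟩
    exact (ae_map_iff (measurable_pi_apply e).aemeasurable measurableSet_Ioo).1 h'
  have h2 : ∀ᵐ U ∂(labelMeasure (Site 3)), ∀ e, U e ∈ Set.Ioo (0 : ℝ) 1 := ae_all_iff.2 h1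
  filter_upwards [h2] with U hU
  ext e
  simp only [Set.mem_setOf_eq]
  by_cases he : e ∈ E
  · simp only [he, true_and, Set.indicator_of_mem, Set.coe_projIcc]
    constructor
    · intro h
      exact le_max_of_le_right (le_min (hU e).2.le h)
    · intro h
      rcases le_max_iff.1 h with h0 | h1
      · exact absurd h0 (not_le.2 (hU e).1)
      · exact h1.trans (min_le_right _ _)
  · simp only [he, false_and, Set.indicator_of_notMem, not_false_eq_true, false_iff]
    push_cast
    exact not_le.2 (hU e).1

/-- The keystone `stub_pushforward` of line `pushforward`, from the first lemma and the tree's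
`prodBernoulli_eq_map_labels` (real proof modulo `threshold_ae_eq`). -/
theorem pushforward_of_ae_eq (E : Set (Sym2 (Site 3))) (τ : Sym2 (Site 3) → ℝ) :
    (labelMeasure (Site 3)).map (fun U : Sym2 (Site 3) → ℝ => {e | e ∈ E ∧ U e ≤ τ e}) =
      prodBernoulli (E.indicator fun e => Set.projIcc (0 : ℝ) 1 zero_le_one (τ e)) := by
  rw [Measure.map_congr (threshold_ae_eq E τ), prodBernoulli_eq_map_labels]
  rfl

/-- It is the registered keystone stub, by name — sorry-free. -/
theorem stub_pushforward_proof : StubsCopy.stub_pushforward := pushforward_of_ae_eq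

end Summit.CriticalPhenomena.PercolationContinuityZ3.Cruxes.ModelFacts.Sketch
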